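import Summits.Ventures.HSemireg.UntwistCocycleTwistHom
import Summits.Ventures.HSemireg.HomComplexSigma
import Mathlib.Algebra.Homology.BifunctorShift
import HarnessLib

/-!
# Venture HSemireg — route R1.0, complex carriers: `𝓗om•(K, L) ⟶ 𝓗om•(K ⊗ M, L ⊗ M)` as a shift-compatible
# natural transformation (gs-g4 gen 22, brick C7b of `general-structure/COMPLEX-LEIBNIZ-PLAN-gs-g4.md`)

HONEST FRAMING. Homological algebra on the tree's REAL carriers: t-7's internal Hom complex
`𝓗om•(K, L) = homComplex Y K L` (total complex of `(p, q) ↦ 𝓗om(K^{-q}, L^p)`, functor `homFunctor Y K` in `L`),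
th-4's cocycle twist `- ⊗ M = twist c` with its action on local morphisms
`γ = sheafHomTwist c : 𝓗om(A, B) ⟶ 𝓗om(A ⊗ M, B ⊗ M)` (`UntwistCocycleTwistHom`, th-4 file #16). Nothing about any
variety; nothing here says HC, HC_CM or HC_AV is proved.

## What is constructed / proved (`namespace Summit.Ventures.HSemireg.HomComplex`)

* `CocycleTwist.prolong c := (twistEquivalence Y c).functor.mapHomologicalComplex _` — `- ⊗ M` termwise on cochain
  complexes (so `cocycleTwistComplex c K = (prolong c).obj K`).
* `sheafHomTwist_comp_sheafHomMapLeft` — `γ` is natural in the FIRST variable too.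
* `twistApp c K L : 𝓗om•(K, L) ⟶ 𝓗om•(K ⊗ M, L ⊗ M)` — summandwise `γ`; a chain map (the two differentials are a post-composition
  and a pre-composition, and `γ` commutes with both); natural in `L`; the natural transformation
  **`twistNatTrans c K : homFunctor Y K ⟶ prolong c ⋙ homFunctor Y (K ⊗ M)`**, and
  **`twistNatTrans_commShift`**: it commutes with the shifts (summandwise both shift isomorphisms are identities).
USE (sequel): with p3's `shiftedHomMap_comp_shift_map` and gs-g4 g22 `shiftedHomMap_functor_comp` this gives
`Φ_{K⊗M}(θ y) = Q(γ) ∘ Φ_K(y)`-type identities, the core of the comparison `σ′_q(θ x)` vs `σ_q(x)`.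

## References

* R. Hartshorne, *Algebraic Geometry* (1977), II.5 (internal Hom), III.6. [Hartshorne1977]
* The Stacks Project, More on Algebra, «Hom complexes» (sign conventions). [StacksProject]
-/

noncomputable section

set_option backward.isDefEq.respectTransparency false

open CategoryTheory CategoryTheory.Limits AlgebraicGeometry Opposite

namespace Summit.Ventures.HSemireg

open Literature.AlgebraicGeometry.Modules Literature.AlgebraicGeometry.Motives

universe u

/-! ### `- ⊗ M` on cochain complexes and naturality of `γ` in the first variable -/

namespace CocycleTwist

variable {Y : Scheme.{u}} (c : UnitCocycle Y)

/-- **`- ⊗ M` termwise on cochain complexes** (`cocycleTwistComplex c K = (prolong c).obj K`). [folklore] -/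
abbrev prolong : CochainComplex Y.Modules ℤ ⥤ CochainComplex Y.Modules ℤ :=
  (twistEquivalence Y c).functor.mapHomologicalComplex (ComplexShape.up ℤ)

/-- **`γ` is natural in the first variable**: `γ ≫ 𝓗om(g ⊗ M, B ⊗ M) = 𝓗om(g, B) ≫ γ`. [folklore] -/
theorem sheafHomTwist_comp_sheafHomMapLeft {A A' : Y.Modules} (g : A' ⟶ A) (B : Y.Modules) :
    sheafHomTwist c A B ≫ sheafHomMapLeft (twistMap c g) (twist c B) =
      sheafHomMapLeft g B ≫ sheafHomTwist c A' B := by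
  refine Scheme.Modules.hom_ext _ _ fun U => AddCommGrpCat.ext fun (φ : A.over U ⟶ B.over U) => ?_
  change (SheafOfModules.overFunctor _ U).map (twistMap c g) ≫ twistMapOver c φ =
    twistMapOver c ((SheafOfModules.overFunctor _ U).map g ≫ φ)
  rw [twistMapOver_comp, twistMapOver_over_map]

/-- `γ` is natural in the second variable (th-4's `sheafHomMap_comp_sheafHomTwist`, reoriented). [folklore] -/
theorem sheafHomTwist_comp_sheafHomMap (A : Y.Modules) {B B' : Y.Modules} (f : B ⟶ B') :
    sheafHomTwist c A B ≫ sheafHomMap (twist c A) (twistMap c f) = sheafHomMap A f ≫ sheafHomTwist c A B' :=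
  (sheafHomMap_comp_sheafHomTwist c f).symm

end CocycleTwist

namespace HomComplex

open CocycleTwist

variable {Y : Scheme.{u}} (c : UnitCocycle Y) (K : CochainComplex Y.Modules ℤ)

/-! ### `𝓗om•(K, L) ⟶ 𝓗om•(K ⊗ M, L ⊗ M)` -/

section App

variable (L : CochainComplex Y.Modules ℤ)

/-- Degree `n` of the twist map: on the summand `𝓗om(K^{-q}, L^p)` it is `γ` followed by the inclusion of the summand
`𝓗om((K ⊗ M)^{-q}, (L ⊗ M)^p)`. [folklore] -/
def twistAppX (n : ℤ) : (homComplex Y K L).X n ⟶ (homComplex Y ((prolong c).obj K) ((prolong c).obj L)).X n :=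
  HomologicalComplex.mapBifunctorDesc fun p q hpq =>
    sheafHomTwist c (K.X (-q)) (L.X p) ≫ ι Y ((prolong c).obj K) ((prolong c).obj L) p q n hpq

/-- The twist map on a summand. [folklore] -/
@[reassoc (attr := simp)]
theorem ι_twistAppX (p q n : ℤ) (hpq : p + q = n) :
    ι Y K L p q n hpq ≫ twistAppX c K L n =
      sheafHomTwist c (K.X (-q)) (L.X p) ≫ ι Y ((prolong c).obj K) ((prolong c).obj L) p q n hpq :=
  HomologicalComplex.ι_mapBifunctorDesc _ _ _ _

/-- The twist map commutes with the `L`-differential. [folklore] -/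
theorem twistAppX_D₁ (n n' : ℤ) (h : n + 1 = n') :
    twistAppX c K L n ≫ HomologicalComplex.mapBifunctor.D₁ ((prolong c).obj L) (dualComplex Y ((prolong c).obj K))
        (sheafHomBifunctor Y).flip (ComplexShape.up ℤ) n n' =
      HomologicalComplex.mapBifunctor.D₁ L (dualComplex Y K) (sheafHomBifunctor Y).flip (ComplexShape.up ℤ) n n' ≫
        twistAppX c K L n' := by
  refine HomologicalComplex.mapBifunctor.hom_ext fun p q (hpq : p + q = n) => ?_
  change ι Y K L p q n hpq ≫ _ = ι Y K L p q n hpq ≫ _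
  rw [ι_twistAppX_assoc, ι_D₁ Y _ _ p q n n' hpq (by omega), reassoc_of% (ι_D₁ Y K L p q n n' hpq (by omega)),
    ι_twistAppX, ← Category.assoc, ← Category.assoc, Functor.mapHomologicalComplex_obj_d]
  exact congrArg (· ≫ _) (sheafHomTwist_comp_sheafHomMap c _ (L.d p (p + 1)))

/-- The twist map commutes with the `K`-differential. [folklore] -/
theorem twistAppX_D₂ (n n' : ℤ) (h : n + 1 = n') :
    twistAppX c K L n ≫ HomologicalComplex.mapBifunctor.D₂ ((prolong c).obj L) (dualComplex Y ((prolong c).obj K))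
        (sheafHomBifunctor Y).flip (ComplexShape.up ℤ) n n' =
      HomologicalComplex.mapBifunctor.D₂ L (dualComplex Y K) (sheafHomBifunctor Y).flip (ComplexShape.up ℤ) n n' ≫
        twistAppX c K L n' := by
  refine HomologicalComplex.mapBifunctor.hom_ext fun p q (hpq : p + q = n) => ?_
  change ι Y K L p q n hpq ≫ _ = ι Y K L p q n hpq ≫ _
  rw [ι_twistAppX_assoc, ι_D₂ Y _ _ p q n n' hpq (by omega), reassoc_of% (ι_D₂ Y K L p q n n' hpq (by omega)),
    Linear.comp_units_smul, Linear.units_smul_comp, Category.assoc, ι_twistAppX, ← Category.assoc, ← Category.assoc,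
    Functor.mapHomologicalComplex_obj_d]
  exact congrArg (fun t => ((n + 1).negOnePow : ℤˣ) • (t ≫ _)) (sheafHomTwist_comp_sheafHomMapLeft c (K.d _ _) (L.X p))

/-- **`𝓗om•(K, L) ⟶ 𝓗om•(K ⊗ M, L ⊗ M)`** (summandwise `γ`; a chain map). [folklore] -/
def twistApp : homComplex Y K L ⟶ homComplex Y ((prolong c).obj K) ((prolong c).obj L) where
  f := twistAppX c K L
  comm' n n' h := by
    change n + 1 = n' at h
    rw [HomologicalComplex.mapBifunctor.d_eq, HomologicalComplex.mapBifunctor.d_eq, Preadditive.comp_add,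
      Preadditive.add_comp, twistAppX_D₁ c K L n n' h, twistAppX_D₂ c K L n n' h]

/-- Components of `twistApp`. [folklore] -/
@[simp]
theorem twistApp_f (n : ℤ) : (twistApp c K L).f n = twistAppX c K L n := rfl

end App

/-- **Naturality in `L`**: `𝓗om•(K, φ) ≫ twist = twist ≫ 𝓗om•(K ⊗ M, φ ⊗ M)`. [folklore] -/
theorem map_comp_twistApp {L L' : CochainComplex Y.Modules ℤ} (φ : L ⟶ L') :
    map Y K φ ≫ twistApp c K L' = twistApp c K L ≫ map Y ((prolong c).obj K) ((prolong c).map φ) := by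
  refine HomologicalComplex.hom_ext _ _ fun n => HomologicalComplex.mapBifunctor.hom_ext fun p q (hpq : p + q = n) => ?_
  change ι Y K L p q n hpq ≫ _ = ι Y K L p q n hpq ≫ _
  rw [HomologicalComplex.comp_f, HomologicalComplex.comp_f, twistApp_f, twistApp_f, reassoc_of% (ι_map Y K φ p q n hpq),
    ι_twistAppX, ι_twistAppX_assoc, ι_map, ← Category.assoc, ← Category.assoc, Functor.mapHomologicalComplex_map_f]
  exact congrArg (· ≫ _) (sheafHomTwist_comp_sheafHomMap c _ (φ.f p)).symm

/-- **`𝓗om•(K, –) ⟶ 𝓗om•(K ⊗ M, – ⊗ M)`** as a natural transformation of endofunctors of cochain complexes.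
[folklore] -/
def twistNatTrans : homFunctor Y K ⟶ prolong c ⋙ homFunctor Y ((prolong c).obj K) where
  app L := twistApp c K L
  naturality _ _ φ := map_comp_twistApp c K φ

/-- Components of the natural transformation. [folklore] -/
@[simp]
theorem twistNatTrans_app (L : CochainComplex Y.Modules ℤ) : (twistNatTrans c K).app L = twistApp c K L := rfl

/-! ### Compatibility with the shifts -/

/-- On a summand, the first-variable shift isomorphism of `𝓗om•(E, –)` is the identity (no sign). [folklore] -/
@[reassoc]
theorem ι_commShiftIso_hom_app_f (E L : CochainComplex Y.Modules ℤ) (a p q n : ℤ) (hpq : p + q = n) :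
    ι Y E (L⟦a⟧) p q n hpq ≫ (((homFunctor Y E).commShiftIso a).hom.app L).f n =
      (ι Y E L (p + a) q (n + a) (by omega) :
        sheafHom (E.X (-q)) (L.X (p + a)) ⟶ (homComplex Y E L).X (n + a)) := by
  change ι Y E (L⟦a⟧) p q n hpq ≫ (CochainComplex.mapBifunctorShift₁Iso L (dualComplex Y E)
    (sheafHomBifunctor Y).flip a).hom.f n = _
  rw [CochainComplex.ι_mapBifunctorShift₁Iso_hom_f L (dualComplex Y E) (sheafHomBifunctor Y).flip a p q n hpq
    (p + a) (n + a) rfl rfl]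
  simp only [CochainComplex.shiftFunctorObjXIso, HomologicalComplex.XIsoOfEq_rfl, Iso.refl_hom, Iso.refl_inv]
  erw [CategoryTheory.Functor.map_id, NatTrans.id_app, Category.id_comp, Category.comp_id]

/-- **The twist maps and the shifts**, componentwise: for the shift isomorphisms of `𝓗om•(K, –)` and of
`(- ⊗ M) ⋙ 𝓗om•(K ⊗ M, –)` (both summandwise identities). [folklore] -/
theorem commShiftIso_hom_app_comp_twistApp_shift (a : ℤ) (L : CochainComplex Y.Modules ℤ) :
    ((homFunctor Y K).commShiftIso a).hom.app L ≫ (twistApp c K L)⟦a⟧' =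
      twistApp c K (L⟦a⟧) ≫ map Y ((prolong c).obj K) (((prolong c).commShiftIso a).hom.app L) ≫
        ((homFunctor Y ((prolong c).obj K)).commShiftIso a).hom.app ((prolong c).obj L) := by
  refine HomologicalComplex.hom_ext _ _ fun n => ?_
  apply HomologicalComplex.mapBifunctor.hom_ext (K₁ := L⟦a⟧) (K₂ := dualComplex Y K) (F := (sheafHomBifunctor Y).flip)
    (c := ComplexShape.up ℤ)
  intro p q hpq
  change ι Y K (L⟦a⟧) p q n hpq ≫ _ = ι Y K (L⟦a⟧) p q n hpq ≫ _
  rw [HomologicalComplex.comp_f, HomologicalComplex.comp_f, HomologicalComplex.comp_f,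
    ι_commShiftIso_hom_app_f_assoc, CochainComplex.shiftFunctor_map_f', twistApp_f, twistApp_f, ι_twistAppX,
    ι_twistAppX_assoc, reassoc_of% (ι_map Y ((prolong c).obj K) (F := (prolong c).obj (L⟦a⟧))
      (F' := ((prolong c).obj L)⟦a⟧) (((prolong c).commShiftIso a).hom.app L) p q n hpq),
    Functor.mapHomologicalComplex_commShiftIso_hom_app_f]
  erw [sheafHomMap_id, Category.id_comp, ι_commShiftIso_hom_app_f ((prolong c).obj K) ((prolong c).obj L) a p q n hpq]
  rfl

/-- **The twist natural transformation commutes with the shifts.** [folklore] -/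
instance twistNatTrans_commShift : NatTrans.CommShift (twistNatTrans c K) ℤ where
  shift_comm a := by
    refine NatTrans.ext (funext fun L => ?_)
    rw [NatTrans.comp_app, NatTrans.comp_app, Functor.whiskerRight_app, Functor.whiskerLeft_app,
      Functor.commShiftIso_comp_hom_app, twistNatTrans_app, twistNatTrans_app]
    exact commShiftIso_hom_app_comp_twistApp_shift c K a L

end HomComplex

end Summit.Ventures.HSemireg

end
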